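import Literature.NumberTheory.EllipticCurves.LocalPointsIntegersSubgroup
import Literature.NumberTheory.EllipticCurves.SelmerLocalRestrictionKernel
import Literature.NumberTheory.EllipticCurves.TateModuleBaseChange
import Literature.NumberTheory.EllipticCurves.SelmerCorankProofs
import Literature.NumberTheory.EllipticCurves.Kobayashi2003.SignedSelmer
import Literature.NumberTheory.EllipticCurves.Rank1Residual.Predicates
import HarnessLib

/-!
# LEV0@2 — `E(ℚ₂) ⊄ 2·E(ℚ₂)` on the tree's local points — the registered stub `stub_localNonDivTwo` of line `eulerchar` v5
# (K4 `SignedControlAtTwo`, stmt-BirchSwinnertonDyer-20309) PROVED: for every elliptic `W/ℚ`, every `ℤ₂`-extension datum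
# and the place `v ∋ 2`, the `Γ_{ℚ_v}`-fixed local points `E(ℚ_v)` carry a point not divisible by `2` in `E(ℚ_v)`

Route `ThetaPartnerAtTwo` (TP2; crux shared with RTT), crux K4, line `eulerchar` v5 (skeleton ed67af6018b68521, lead
`prover-bsd-wall-tp2-p3` g2); seat `prover-bsd-wall-tp2-p3-w3` (width seat 3/3).

WHAT. The v5 stub `stub_localNonDivTwo` (LEV0@2) asks, on the sub-row `¬CM, r_an = 0, GoodSS 2, a₂ = 0`, for a point
`m₀ ∈ E(ℚ_v)` (= the local points `localLayerPointsOfEmb κ (closureEmb ℚ_v) W 0`, i.e. the points of `E(K̄_v)` fixed by all of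
`Γ_{ℚ_v}`) with `m₀ ≠ 2·b` for every `b ∈ E(ℚ_v)`. This holds for EVERY elliptic curve over a number field at every place `v`
with `#(𝒪_v/2𝒪_v) ≠ 1`, by Milne, *ADT* I Lemma 3.3 (tree theorem `WeierstrassCurve.card_quotient_range_nsmul_adicCompletion`:
`#E(K_v)/nE(K_v) = #E(K_v)[n] · #(𝒪_v/n𝒪_v)`), so none of the habitat hypotheses is used:
* §1 `exists_point_ne_nsmul_adicCompletion` — `∃ P ∈ E(K_v), ∀ Q, P ≠ n • Q` as soon as `#(𝒪_v/n𝒪_v) ≠ 1` (Mathlib points of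
  `W ⊗ K_v`).
* §2 `exists_mem_localLayerPointsOfEmb_zero_ne_nsmul` — the same on the tree's local points: `E(K_v)`-points are the
  `Γ_{K_v}`-fixed points of `E(K̄_v)` (`toGeomPoints`, `smul_toGeomPoints`, Galois descent `exists_toGeomPoints_eq_of_forall_smul_eq`
  along `localPointsEquivBaseChange`).
* §3 (`K = ℚ`, `n = 2`, `v ∋ 2`, `#(ℤ_v/2) = 2`: `natCard_adicCompletionIntegers_quot_span_prime`)
  `exists_mem_localLayerPointsOfEmb_zero_ne_two_nsmul` and **`stub_localNonDivTwo`** — the registered stub VERBATIM.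

HONEST FRAMING: THEOREMS ONLY (no definition, no named fact, no `sorry`), route-independent (no `Theses` import); closes the
stub `stub_localNonDivTwo` of the registered skeleton of stmt-BirchSwinnertonDyer-20309 and nothing else; BSD is not proved by
any of this.

References: [MilneADT2006] J. S. Milne, *Arithmetic Duality Theorems*, 2nd ed., I Lemma 3.3; [SilvermanAEC2009] J. H. Silverman,
*The Arithmetic of Elliptic Curves*, 2nd ed., Prop. VII.6.3, VIII.§1; [Kobayashi2003] S. Kobayashi, Invent. Math. 152 (2003), §8.4
(the generator of `Ê(pℤ_p)`).
-/

set_option autoImplicit false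
-- the Theorems namespace of this sub repeats the summit name by design (D-0017 nested layout)
set_option linter.dupNamespace false

noncomputable section

open scoped Classical NumberField

open NumberField IsDedekindDomain WeierstrassCurve Literature.NumberTheory.EllipticCurves
  Literature.NumberTheory.EllipticCurves.Kobayashi2003

universe u

namespace Summit.BirchSwinnertonDyer.BirchSwinnertonDyer.Theorems.SignedEC

/-! ## §1 A non-`n`-divisible point of `E(K_v)` from Milne I Lemma 3.3 -/

section General

variable {K : Type u} [Field K] [NumberField K] (W : WeierstrassCurve K) [W.IsElliptic]
  (v : HeightOneSpectrum (𝓞 K))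

/-- **`E(K_v) ≠ n·E(K_v)` when `#(𝒪_v/n𝒪_v) ≠ 1`**: by Milne I Lemma 3.3 the index `[E(K_v) : nE(K_v)] = #E(K_v)[n]·#(𝒪_v/n𝒪_v)`
is not `1`, so some point of `E(K_v)` is not an `n`-th multiple. [cite: MilneADT2006, I Lemma 3.3] [cite: SilvermanAEC2009, Prop. VII.6.3] -/
theorem exists_point_ne_nsmul_adicCompletion {n : ℕ} (hn : n ≠ 0)
    (hO : Nat.card (v.adicCompletionIntegers K ⧸ Ideal.span {(n : v.adicCompletionIntegers K)}) ≠ 1) :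
    ∃ P : (W.baseChange (v.adicCompletion K)).toAffine.Point,
      ∀ Q : (W.baseChange (v.adicCompletion K)).toAffine.Point, P ≠ n • Q := by
  by_contra h
  simp only [not_exists, not_forall, not_not] at h
  -- then `nE(K_v) = E(K_v)`, so the index is `1`
  have hr : (nsmulAddMonoidHom n : (W.baseChange (v.adicCompletion K)).toAffine.Point →+ _).range = ⊤ := by
    rw [AddMonoidHom.range_eq_top]
    intro P
    obtain ⟨Q, hQ⟩ := h P
    exact ⟨Q, by rw [nsmulAddMonoidHom_apply, hQ]⟩
  haveI := W.finite_ker_nsmul_adicCompletion v hn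
  have hcard := W.card_quotient_range_nsmul_adicCompletion v hn
  rw [← AddSubgroup.index, hr, AddSubgroup.index_top] at hcard
  have hker : Nat.card (nsmulAddMonoidHom n : (W.baseChange (v.adicCompletion K)).toAffine.Point →+ _).ker ≠ 0 :=
    Nat.card_pos.ne'
  exact hO (Nat.eq_one_of_mul_eq_one_left hcard.symm)

/-! ## §2 The same on the tree's local points `E(K̄_v)^{Γ_{K_v}}` -/

omit [W.IsElliptic] in
/-- **A `Γ_{K_v}`-fixed local point not divisible by `n` among the fixed points**, from a point of `E(K_v)` which is not an
`n`-th multiple in `E(K_v)`: `E(K_v) ↪ E(K̄_v)` has `Γ_{K_v}`-fixed image (`smul_toGeomPoints`), and a `Γ_{K_v}`-fixed point of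
`E(K̄_v)` descends to `E(K_v)` (`exists_toGeomPoints_eq_of_forall_smul_eq`; `K_v` is perfect), all transported along
`localPointsEquivBaseChange`. The layer-`0` local points `localLayerPointsOfEmb κ ι W 0` are exactly the `Γ_{K_v}`-fixed points
(`mem_localLayerPointsOfEmb_zero_iff`), for any `ℤ_p`-extension `κ` and embedding `ι`. [cite: SilvermanAEC2009, VIII.§1] -/
theorem exists_mem_localLayerPointsOfEmb_zero_ne_nsmul {p : ℕ} [Fact p.Prime] (κ : ZpExtension K p)
    (ι : AlgebraicClosure K →ₐ[K] AlgebraicClosure (v.adicCompletion K)) {n : ℕ}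
    (h : ∃ P : (W.baseChange (v.adicCompletion K)).toAffine.Point,
      ∀ Q : (W.baseChange (v.adicCompletion K)).toAffine.Point, P ≠ n • Q) :
    ∃ m₀ ∈ localLayerPointsOfEmb κ ι W 0, ∀ b ∈ localLayerPointsOfEmb κ ι W 0, m₀ ≠ n • b := by
  haveI : PerfectField (v.adicCompletion K) := by
    haveI : CharZero (v.adicCompletion K) := charZero_of_injective_algebraMap (algebraMap K _).injective
    infer_instance
  obtain ⟨P, hP⟩ := h
  set e := localPointsEquivBaseChange W (v.adicCompletion K) with he
  refine ⟨e.symm (toGeomPoints (W.baseChange (v.adicCompletion K)) P), ?_, fun b hb hmb ↦ ?_⟩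
  · rw [mem_localLayerPointsOfEmb_zero_iff]
    intro τ
    apply e.injective
    rw [localPointsEquivBaseChange_smul, AddEquiv.apply_symm_apply, smul_toGeomPoints]
  · -- `b` is fixed, hence rational: `e b = toGeomPoints Q₀`
    have hbfix : ∀ σ : Field.absoluteGaloisGroup (v.adicCompletion K), σ • e b = e b := fun σ ↦ by
      rw [← localPointsEquivBaseChange_smul, (mem_localLayerPointsOfEmb_zero_iff κ ι W b).1 hb σ]
    obtain ⟨Q₀, hQ₀⟩ := WeierstrassCurve.exists_toGeomPoints_eq_of_forall_smul_eq (W.baseChange (v.adicCompletion K)) hbfix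
    apply hP Q₀
    apply WeierstrassCurve.toGeomPoints_injective (W.baseChange (v.adicCompletion K))
    have h1 := congrArg e hmb
    rw [AddEquiv.apply_symm_apply, map_nsmul, ← hQ₀, ← map_nsmul] at h1
    exact h1

end General

/-! ## §3 `K = ℚ`, `n = 2`, `v ∋ 2`: the registered stub `stub_localNonDivTwo` -/

section Two

/-- **LEV0@2 for every elliptic `W/ℚ`**: for any `ℤ₂`-extension `κ` and the place `v ∋ 2`, the layer-`0` local points
`E(ℚ_v) = localLayerPointsOfEmb κ (closureEmb ℚ_v) W 0` carry a point `m₀` with `m₀ ≠ 2·b` for all `b ∈ E(ℚ_v)`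
(`#E(ℚ_v)/2E(ℚ_v) = 2·#E(ℚ_v)[2] ≥ 2`, Milne I Lemma 3.3 with `#(ℤ_v/2ℤ_v) = 2`). [cite: MilneADT2006, I Lemma 3.3]
[cite: SilvermanAEC2009, Prop. VII.6.3] -/
theorem exists_mem_localLayerPointsOfEmb_zero_ne_two_nsmul (W : WeierstrassCurve ℚ) [W.IsElliptic]
    (κ : ZpExtension ℚ 2) (v : HeightOneSpectrum (𝓞 ℚ)) (hv : (2 : 𝓞 ℚ) ∈ v.asIdeal) :
    ∃ m₀ ∈ localLayerPointsOfEmb κ (closureEmb (K := ℚ) (v.adicCompletion ℚ)) W 0,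
      ∀ b ∈ localLayerPointsOfEmb κ (closureEmb (K := ℚ) (v.adicCompletion ℚ)) W 0, m₀ ≠ 2 • b := by
  refine exists_mem_localLayerPointsOfEmb_zero_ne_nsmul W v κ _ (exists_point_ne_nsmul_adicCompletion W v two_ne_zero ?_)
  haveI : Fact (Nat.Prime 2) := ⟨Nat.prime_two⟩
  have h2 := WeierstrassCurve.natCard_adicCompletionIntegers_quot_span_prime (p := 2) (v := v) (by exact_mod_cast hv)
  rw [h2]
  norm_num

end Two

end Summit.BirchSwinnertonDyer.BirchSwinnertonDyer.Theorems.SignedEC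

namespace Summit.BirchSwinnertonDyer.BirchSwinnertonDyer.Cruxes.SignedControlAtTwo.EulerChar

open Literature.NumberTheory.EllipticCurves.Rank1Residual

/-- **The registered stub `stub_localNonDivTwo` (LEV0@2) of line `eulerchar` v5 of K4 `SignedControlAtTwo`
(stmt-BirchSwinnertonDyer-20309), PROVED** — verbatim signature; the habitat hypotheses are not used: for every elliptic `W/ℚ`,
every `ℤ₂`-extension `κ` and the place `v ∋ 2`, `E(ℚ_v)` carries a point not divisible by `2` in `E(ℚ_v)`
(`SignedEC.exists_mem_localLayerPointsOfEmb_zero_ne_two_nsmul`, Milne I Lemma 3.3). [cite: MilneADT2006, I Lemma 3.3]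
[cite: SilvermanAEC2009, Prop. VII.6.3] -/
theorem stub_localNonDivTwo :
    ∀ (W : WeierstrassCurve ℚ) [W.IsElliptic] [W.IsGloballyMinimal],
      ¬ W.HasCM → W.analyticRank = 0 → GoodSS W 2 → W.frobeniusTrace 2 = 0 →
      ∀ (κ : ZpExtension ℚ 2), κ.IsCyclotomic →
      ∀ (v : HeightOneSpectrum (𝓞 ℚ)), (2 : 𝓞 ℚ) ∈ v.asIdeal →
      ∃ m₀ ∈ localLayerPointsOfEmb κ (closureEmb (K := ℚ) (v.adicCompletion ℚ)) W 0,
        ∀ b ∈ localLayerPointsOfEmb κ (closureEmb (K := ℚ) (v.adicCompletion ℚ)) W 0, m₀ ≠ 2 • b :=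
  fun W _ _ _ _ _ _ κ _ v hv ↦
    Summit.BirchSwinnertonDyer.BirchSwinnertonDyer.Theorems.SignedEC.exists_mem_localLayerPointsOfEmb_zero_ne_two_nsmul W κ v hv

end Summit.BirchSwinnertonDyer.BirchSwinnertonDyer.Cruxes.SignedControlAtTwo.EulerChar

end
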